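import Mathlib
import Summits.NavierStokesRegularity.NavierStokesRegularity.Theorems.TaoLadderRungTwoBreakBlowupRigidityOneRayReduction
import Summits.NavierStokesRegularity.NavierStokesRegularity.Theorems.WakeRatchetAdmissibleEternalBoundDyadic
import HarnessLib

/-!
# RAY EMBEDDING OF ETERNAL SOLUTIONS: every admissible (viscous) eternal solution of the dyadic member rides on every
  normalised INVARIANT RAY of a cancelling table, with the same covariant viscosity, the same bounds and the same forward
  survival — so every K1-type statement of route TaoLadderRungTwoBreak (the deciding crux K1ᵛ(1)
  `NoSurvivingEternalViscBddOne` ⟨20419⟩, its children ⟨20451⟩/⟨20452⟩, K1(1) ⟨20205⟩) and the hypothesis class of the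
  classification stub of K2(1) ⟨20206⟩ CONTAIN their dyadic member on every table with an invariant ray — the general
  form of `…NoSurvivingEternalViscBddOneTwinRotorEmbedding` (`--supports`)

MODEL lattice ODEs only (Tao 2016 §1.2, §4 Lemma 4.1 (4.8), the viscous equation before Thm. 4.2, §6.4); nothing here is a
statement about the Navier–Stokes equations; NO item is closed.  DEF-FREE (the ray embedding is the lambda
`fun n σ => (W n σ 0) • u`); ROUTE-INDEPENDENT.

* `tables_smul_vec` — vector form of the ray identities `Q(s u) = s² Q(u)`, `A(s u) = s² A(u)`, `B(s' u, s u) = s' s B(u,u)`;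
* `isEternalVisc_ray_of_dyadic` — for a normalised invariant ray `u` (`Q u = 0`, `A u = u`, `B(u,u) = −u`) of `α`
  (any `ε₀`): `IsEternalVisc ε₀ ν̂ dyadicTable W → IsEternalVisc ε₀ ν̂ α (fun n σ => (W n σ 0) • u)` (law by
  `dyadic_hasDerivAt_apply`; action `× ‖u‖`; forward bound `× ‖u‖²`);
* `isEternal_ray_of_dyadic`, `uniformBound_ray`, `norm_ray`, `eternalSurvivingFwd_ray_iff` — the inviscid case, the
  uniform bound, `‖(W n σ 0) • u‖ = ‖W n σ‖·‖u‖` on admissible dyadic solutions, and forward (S_a)-survival is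
  EQUIVALENT along the ray (`u ≠ 0`; levels scale by `‖u‖²`);
* `dyadic_of_noSurvivingEternalViscBdd_ray`, `dyadic_of_noSurvivingEternalBdd_ray` — BY SHAPE: on a table of `E₂(R)`
  with a normalised invariant ray `u ≠ 0`, the conclusions of `NoSurvivingEternalViscBdd R a` / `NoSurvivingEternalBdd R a`
  imply their dyadic slices below the same threshold.

HONEST LABEL: dictionary work; no stub, crux, rung or summit is proved; rung 0.
-/

noncomputable section

-- the summit and its single sub-problem share the name (CONVENTIONS §1)
set_option linter.dupNamespace false

open Set Filter Topology MeasureTheory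
open scoped RealInnerProductSpace

namespace Summit.NavierStokesRegularity.NavierStokesRegularity.Theorems

namespace BlowupRigidityOne

open Literature.Analysis.FluidPDE Literature.Analysis.FluidPDE.TaoCascade
open Summit.NavierStokesRegularity.NavierStokesRegularity.Theorems.WakeRatchetDyadic
  (dyadic_hasDerivAt_apply dyadic_apply_ne_zero)

variable {m : ℕ} {ε₀ νh : ℝ} {α : Fin m → Fin m → Fin m → ℤ × ℤ × ℤ → ℝ} {u : Em m} {W : ℤ → ℝ → Em 4}

/-- Vector form of the ray identities: `Q(s u) = (s s)•Q(u)`, `A(s u) = (s s)•A(u)`, `B(s' u, s u) = (s' s)•B(u,u)`.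
[cite: Tao2016AveragedNS, §4 (4.1), Lemma 4.1 (4.8); cell vocabulary (`tableQ`, `tableA`, `tableB`)] -/
theorem tables_smul_vec (α : Fin m → Fin m → Fin m → ℤ × ℤ × ℤ → ℝ) (u : Em m) (s s' : ℝ) :
    tableQ α (s • u) = (s * s) • tableQ α u ∧ tableA α (s • u) = (s * s) • tableA α u ∧
      tableB α (s' • u) (s • u) = (s' * s) • tableB α u u := by
  refine ⟨?_, ?_, ?_⟩ <;> ext i <;> simp only [PiLp.smul_apply, smul_eq_mul]
  · exact (tables_smul α u s s' i).1
  · exact (tables_smul α u s s' i).2.1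
  · exact (tables_smul α u s s' i).2.2

/-- **THE RAY EMBEDDING OF VISCOUS ETERNAL SOLUTIONS.**  For a normalised invariant ray `u` of `α`
(`Q(u) = 0`, `A(u) = u`, `B(u,u) = −u`), every admissible eternal solution `W` of the renormalised viscous lattice of the
dyadic member with covariant viscosity `ν̂ ≥ 0` yields the admissible eternal solution `(W_n(σ))₀ · u` of `α` with the
SAME `ν̂`: the law holds shell-wise (the dyadic scalar law `w' = Λ w_{n−1}² − Λ⁻¹ w_n w_{n+1} − (1 + ν̂λ^{2n}e^{−σ}) w_n`
times `u`), the action scales by `‖u‖`, the forward energy bound by `‖u‖²`.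
[cite: Tao2016AveragedNS, §1.2, §4 Lemma 4.1 (iii) (4.8), the viscous equation before Thm. 4.2, §6.4; cell vocabulary (`IsEternalVisc`, invariant ray)] -/
theorem isEternalVisc_ray_of_dyadic (hQ : tableQ α u = 0) (hA : tableA α u = u)
    (hB : tableB α u u = -u) (hW : IsEternalVisc ε₀ νh dyadicTable W) :
    IsEternalVisc ε₀ νh α (fun n σ => (W n σ 0) • u) where
  law n σ := by
    have hd := (dyadic_hasDerivAt_apply hW n σ 0).smul_const u
    simp only [if_true] at hd
    refine hd.congr_deriv ?_
    rw [(tables_smul_vec α u (W n σ 0) (W (n + 1) σ 0)).1, (tables_smul_vec α u (W (n - 1) σ 0) 0).2.1,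
      (tables_smul_vec α u (W n σ 0) (W (n + 1) σ 0)).2.2, hQ, hA, hB]
    unfold Literature.Analysis.FluidPDE.TaoCascade.viscCoef
    ext i
    simp only [PiLp.add_apply, PiLp.sub_apply, PiLp.neg_apply, PiLp.smul_apply, PiLp.zero_apply, smul_eq_mul]
    ring
  nonneg := hW.nonneg
  action := by
    obtain ⟨M, hM⟩ := hW.action
    have hcont : ∀ n, Continuous fun σ => (W n σ 0) • u := fun n =>
      continuous_iff_continuousAt.2 fun σ => ((dyadic_hasDerivAt_apply hW n σ 0).smul_const u).continuousAt
    have hle : ∀ n σ, ‖(W n σ 0) • u‖ ≤ ‖W n σ‖ * ‖u‖ := fun n σ => by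
      rw [norm_smul, Real.norm_eq_abs]
      exact mul_le_mul_of_nonneg_right (abs_apply_le_norm (W n σ) 0) (norm_nonneg _)
    refine ⟨M * ‖u‖, fun n => ⟨?_, ?_⟩⟩
    · exact ((hM n).1.mul_const ‖u‖).mono' (hcont n).norm.aestronglyMeasurable
        (Eventually.of_forall fun σ => by rw [norm_norm]; exact hle n σ)
    · calc ∫ σ, ‖(W n σ 0) • u‖ ≤ ∫ σ, ‖W n σ‖ * ‖u‖ :=
            integral_mono_of_nonneg (Eventually.of_forall fun σ => norm_nonneg _) ((hM n).1.mul_const ‖u‖)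
              (Eventually.of_forall fun σ => hle n σ)
        _ = (∫ σ, ‖W n σ‖) * ‖u‖ := integral_mul_const _ _
        _ ≤ M * ‖u‖ := mul_le_mul_of_nonneg_right (hM n).2 (norm_nonneg _)
  bdd n := by
    obtain ⟨σ₀, P, hP⟩ := hW.bdd n
    refine ⟨σ₀, P * ‖u‖ ^ 2, fun σ hσ => ?_⟩
    rw [norm_smul, Real.norm_eq_abs, mul_pow, sq_abs]
    have h1 : W n σ 0 ^ 2 ≤ ‖W n σ‖ ^ 2 := by
      have := abs_apply_le_norm (W n σ) 0
      nlinarith [abs_nonneg (W n σ 0), sq_abs (W n σ 0)]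
    calc Real.exp (2 * σ) * (W n σ 0 ^ 2 * ‖u‖ ^ 2) = Real.exp (2 * σ) * W n σ 0 ^ 2 * ‖u‖ ^ 2 := by ring
      _ ≤ Real.exp (2 * σ) * ‖W n σ‖ ^ 2 * ‖u‖ ^ 2 :=
          mul_le_mul_of_nonneg_right (mul_le_mul_of_nonneg_left h1 (Real.exp_pos _).le) (sq_nonneg _)
      _ ≤ P * ‖u‖ ^ 2 := mul_le_mul_of_nonneg_right (hP σ hσ) (sq_nonneg _)

/-- The inviscid case `ν̂ = 0`. [cite: Tao2016AveragedNS, §4 Lemma 4.1 (iii) (4.8), §6.4; cell vocabulary (`IsEternal`, invariant ray)] -/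
theorem isEternal_ray_of_dyadic (hQ : tableQ α u = 0) (hA : tableA α u = u)
    (hB : tableB α u u = -u) (hW : IsEternal ε₀ dyadicTable W) : IsEternal ε₀ α (fun n σ => (W n σ 0) • u) :=
  isEternalVisc_zero_iff.1 (isEternalVisc_ray_of_dyadic hQ hA hB (isEternalVisc_zero_iff.2 hW))

/-- On admissible (viscous) dyadic solutions every shell is supported on component `0`, so the ray embedding scales
every shell norm by `‖u‖`: `‖(W_n(σ))₀ · u‖ = ‖W_n(σ)‖ ‖u‖`.
[cite: Tao2016AveragedNS, §1.2, §6.4; tree `WakeRatchetDyadic.dyadic_apply_ne_zero`] -/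
theorem norm_ray (hε : 0 < ε₀) (hW : IsEternalVisc ε₀ νh dyadicTable W) (u : Em m) (n : ℤ) (σ : ℝ) :
    ‖(W n σ 0) • u‖ = ‖W n σ‖ * ‖u‖ := by
  rw [norm_smul, Real.norm_eq_abs]
  congr 1
  have h1 : W n σ 1 = 0 := dyadic_apply_ne_zero hε hW n (by decide) σ
  have h2 : W n σ 2 = 0 := dyadic_apply_ne_zero hε hW n (by decide) σ
  have h3 : W n σ 3 = 0 := dyadic_apply_ne_zero hε hW n (by decide) σ
  rw [EuclideanSpace.norm_eq, Fin.sum_univ_four, h1, h2, h3]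
  simp only [Real.norm_eq_abs, abs_zero, ne_eq, OfNat.ofNat_ne_zero, not_false_eq_true, zero_pow, add_zero]
  exact (Real.sqrt_sq (abs_nonneg _)).symm

/-- The ray embedding preserves uniform bounds. [cite: Tao2016AveragedNS, §6.4; cell vocabulary (`UniformBound`)] -/
theorem uniformBound_ray (u : Em m) (hU : UniformBound W) : UniformBound (fun n σ => (W n σ 0) • u) := by
  obtain ⟨C, hC⟩ := hU
  refine ⟨C * ‖u‖, fun k σ => ?_⟩
  rw [norm_smul, Real.norm_eq_abs]
  exact mul_le_mul_of_nonneg_right ((abs_apply_le_norm (W k σ) 0).trans (hC k σ)) (norm_nonneg _)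

/-- **Forward (S_a)-survival is equivalent along a ray** (`u ≠ 0`): the weighted shell energies scale by `‖u‖² > 0`.
[cite: Tao2016AveragedNS, §4 (the viscous equation before Thm. 4.2), §6.4; cell vocabulary (`EternalSurvivingFwd`)] -/
theorem eternalSurvivingFwd_ray_iff (hε : 0 < ε₀) (hW : IsEternalVisc ε₀ νh dyadicTable W) (hu : u ≠ 0) (a : ℝ) :
    EternalSurvivingFwd a ε₀ (fun n σ => (W n σ 0) • u) ↔ EternalSurvivingFwd a ε₀ W := by
  have hpw : 0 ≤ physWeight a ε₀ := physWeight_nonneg hε.le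
  have hu2 : 0 < ‖u‖ ^ 2 := by positivity
  have hsq : ∀ (n : ℕ) σ, ‖(W n σ 0) • u‖ ^ 2 = ‖W n σ‖ ^ 2 * ‖u‖ ^ 2 := fun n σ => by
    rw [norm_ray hε hW u n σ, mul_pow]
  constructor
  · rintro ⟨c, hc, H⟩
    refine ⟨c / ‖u‖ ^ 2, div_pos hc hu2, fun N => ?_⟩
    obtain ⟨n, hn, σ, hσ, hle⟩ := H N
    refine ⟨n, hn, σ, hσ, ?_⟩
    rw [hsq] at hle
    rw [div_le_iff₀ hu2]
    calc c ≤ physWeight a ε₀ ^ n * (Real.exp (2 * σ) * (‖W n σ‖ ^ 2 * ‖u‖ ^ 2)) := hle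
      _ = physWeight a ε₀ ^ n * (Real.exp (2 * σ) * ‖W n σ‖ ^ 2) * ‖u‖ ^ 2 := by ring
  · rintro ⟨c, hc, H⟩
    refine ⟨c * ‖u‖ ^ 2, mul_pos hc hu2, fun N => ?_⟩
    obtain ⟨n, hn, σ, hσ, hle⟩ := H N
    refine ⟨n, hn, σ, hσ, ?_⟩
    rw [hsq]
    calc c * ‖u‖ ^ 2 ≤ physWeight a ε₀ ^ n * (Real.exp (2 * σ) * ‖W n σ‖ ^ 2) * ‖u‖ ^ 2 :=
          mul_le_mul_of_nonneg_right hle hu2.le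
      _ = physWeight a ε₀ ^ n * (Real.exp (2 * σ) * (‖W n σ‖ ^ 2 * ‖u‖ ^ 2)) := by ring

/-! ## By shape: K1-type statements on a ray table contain their dyadic slice -/

/-- **K1ᵛ on a table with an invariant ray ⟹ its viscous dyadic slice.**  If `α ∈ E₂(R)` has a normalised invariant ray
`u ≠ 0`, then `NoSurvivingEternalViscBdd R a` excludes, below its threshold, every uniformly bounded (S_a)-surviving
admissible viscous eternal solution OF THE DYADIC MEMBER (any `ν̂ ≥ 0`) — the ray embedding would be one of `α`.
[cite: Tao2016AveragedNS, §4 Thm. 4.2 (statement shape), the viscous equation before it, §6.4; cell vocabulary (`NoSurvivingEternalViscBdd`, invariant ray)] -/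
theorem dyadic_of_noSurvivingEternalViscBdd_ray {R a : ℝ} {α : Fin 4 → Fin 4 → Fin 4 → ℤ × ℤ × ℤ → ℝ} {u : Em 4}
    (hα : InTableClass R α) (hQ : tableQ α u = 0) (hA : tableA α u = u) (hB : tableB α u u = -u) (hu : u ≠ 0)
    (h : NoSurvivingEternalViscBdd R a) :
    ∃ εs : ℝ, 0 < εs ∧ ∀ ε₀ : ℝ, 0 < ε₀ → ε₀ ≤ εs →
      ∀ (νh : ℝ) (W : ℤ → ℝ → Em 4), IsEternalVisc ε₀ νh dyadicTable W → UniformBound W →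
        ¬ EternalSurvivingFwd a ε₀ W := by
  obtain ⟨εs, hεs, H⟩ := h
  refine ⟨εs, hεs, fun ε₀ hε hle νh W hW hU hS => ?_⟩
  exact H ε₀ hε hle α hα νh _ (isEternalVisc_ray_of_dyadic hQ hA hB hW) (uniformBound_ray u hU)
    ((eternalSurvivingFwd_ray_iff hε hW hu a).2 hS)

/-- **The bounded INVISCID Liouville statement on a ray table ⟹ its dyadic slice** (`NoSurvivingEternalBdd R a`).
[cite: Tao2016AveragedNS, §4 Thm. 4.2 (statement shape), §6.4; cell vocabulary (`NoSurvivingEternalBdd`, invariant ray)] -/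
theorem dyadic_of_noSurvivingEternalBdd_ray {R a : ℝ} {α : Fin 4 → Fin 4 → Fin 4 → ℤ × ℤ × ℤ → ℝ} {u : Em 4}
    (hα : InTableClass R α) (hQ : tableQ α u = 0) (hA : tableA α u = u) (hB : tableB α u u = -u) (hu : u ≠ 0)
    (h : NoSurvivingEternalBdd R a) :
    ∃ εs : ℝ, 0 < εs ∧ ∀ ε₀ : ℝ, 0 < ε₀ → ε₀ ≤ εs →
      ∀ W : ℤ → ℝ → Em 4, IsEternal ε₀ dyadicTable W → UniformBound W → ¬ EternalSurvivingFwd a ε₀ W := by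
  obtain ⟨εs, hεs, H⟩ := h
  refine ⟨εs, hεs, fun ε₀ hε hle W hW hU hS => ?_⟩
  exact H ε₀ hε hle α hα _ (isEternal_ray_of_dyadic hQ hA hB hW) (uniformBound_ray u hU)
    ((eternalSurvivingFwd_ray_iff hε (isEternalVisc_zero_iff.2 hW) hu a).2 hS)

end BlowupRigidityOne

end Summit.NavierStokesRegularity.NavierStokesRegularity.Theorems

end
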